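import Mathlib
import Summits.NavierStokesRegularity.NavierStokesRegularity.Theorems.EulerZoomLiouvillePowerGaugeEulerLiouvilleEvanescentPatternTools
import HarnessLib

/-!
# Crux `EulerZoomLiouville.PowerGaugeEulerLiouville` (stmt-NavierStokesRegularity-19832), stub `stub_nonSelfSimilarRest`:
# a steady field plus an EVANESCENT square-integrably modulated `C¹` pattern is trivial

Helper file (theorems only; `--supports stmt-NavierStokesRegularity-19832`; def-free).  Hand leafhand-ns-eulerzoomliouville-11 g0;
assembly of the `E`-gauge two-pattern engine (`…EvanescentPatternTools`) — census item T-e of this hand.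

THE STRATUM (`0 < ρ ≤ ½`): `u(τ, x) = U₀(x) + θ(τ) U₁(x)` for a.e. `(τ, x) ∈ (−∞,T₁) × ℝ³`, `U₀, U₁` ARBITRARY, `θ ∈ C¹(ℝ)` with
`θ(τ) → 0` as `τ → −∞` and a square-integrable tail `∫_{(−b²,T₁)} θ² ≤ κ` (all `b`) ⇒ `u = 0` a.e.
(`Evanescent.ae_eq_zero_of_gauge_of_aeEvanescentPattern`, binder `Birth.nonSelfSimilar_of_aeEvanescentPattern`).  After the
renormalisation `U₀ ↦ U₀ + rU₁`, `θ ↦ θ − r` this covers the EVANESCENT RICCATI modulations left by `…ModulatedEulerPast`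
(`r + K e^{βτ}` with `β > 0`, the logistic branch, `r + 1/(γ(t⋆ − τ))`): the last named residual of the `C¹` pattern lane.

PROOF.  `θ ≡ 0` on the past: `AePastSteady`.  Otherwise good slices `τa` (window where `|θ| > 2ε`) and `τb` (far past, `|θ| ≤ ε`)
give weak gradients with `H(t) = G₀ + θ(t)G₁` (`Evanescent.gradients_of_two_slices`); the engine gives `∫_{B_b}|G₁|²_F ≲ b^{1−ρ}`,
then `∫_{B_b}|G₀|²_F ≲ b^{−1−ρ} → 0`: `G₀ = 0`, `U₀ ≡ C₀`; the two-slice `A`-gauge estimate and the constant kill give `C₀ = 0`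
(`Evanescent.const_eq_zero_of_two_slices`); `u = θ(τ)U₁` is then separable with `θ ∈ C¹`: trivial by `…SeparableCollapseBridge`.

WHAT THIS IS NOT: not a proof of the stub or of the crux; nothing about Navier–Stokes. [folklore]
-/

noncomputable section

-- flat `Theorems/<Route><Decl>…` files of one crux share the namespace of the crux (tree convention)
set_option linter.dupNamespace false

open MeasureTheory Set Filter Topology Metric Function TopologicalSpace
open scoped RealInnerProductSpace NNReal ENNReal

namespace Summit.NavierStokesRegularity.NavierStokesRegularity.Theorems.PowerGaugeEulerLiouville

open Literature.Analysis Literature.Analysis.FunctionSpaces Literature.Analysis.FluidPDE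

namespace Evanescent

/-- `‖a − b‖ₑ² ≤ 2 (‖a‖ₑ² + ‖b‖ₑ²)`. [folklore] -/
theorem enorm_sq_sub_le' (a b : EuclideanSpace ℝ (Fin 3)) : ‖a - b‖ₑ ^ 2 ≤ 2 * (‖a‖ₑ ^ 2 + ‖b‖ₑ ^ 2) := by
  have h := AffinePast.enorm_sq_smul_sub_le b (a - b) 0 1
  simp only [sub_zero, one_smul, zero_smul, add_zero] at h
  rwa [show b + (a - b) = a by abel] at h

/-- From a window bound `V · I ≤ ofReal (K b^{1−ρ})` with `V ≥ ofReal (b²/2)`: `I ≤ ofReal (2K b^{−1−ρ})`. [folklore] -/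
theorem le_of_window_mul_le {V I : ℝ≥0∞} {K b ρ : ℝ} (hb : 0 < b) (hV : ENNReal.ofReal (b ^ 2 / 2) ≤ V)
    (h : V * I ≤ ENNReal.ofReal (K * b ^ (1 - ρ))) : I ≤ ENNReal.ofReal (2 * K * b ^ (-(1 + ρ))) := by
  have hYpos : 0 < b ^ 2 / 2 := by positivity
  have h' : V * I ≤ 4 * ENNReal.ofReal (K * b ^ (1 - ρ) / 4) := by
    rw [← ENNReal.ofReal_ofNat, ← ENNReal.ofReal_mul (by norm_num)]
    refine h.trans (le_of_eq ?_)
    congr 1; ring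
  refine (ModulatedPast.lintegral_le_of_gap (X := V) (I := I) hYpos hV h').trans (le_of_eq ?_)
  congr 1
  rw [show (-(1 + ρ) : ℝ) = (1 - ρ) - 2 by ring, Real.rpow_sub hb (1 - ρ) 2, Real.rpow_two]
  field_simp

/-- **Constant kill from two slices**: if `U₀ = C₀` a.e. and the slices `U₀ + θᵢ U₁` (`θa ≠ θb`) satisfy the `A`-gauge bound on all
balls of radius `≥ L₀ ≥ 1`, then `C₀ = 0`. [folklore] -/
theorem const_eq_zero_of_two_slices {ρ : ℝ} (hρ : 0 < ρ) {c : ℝ≥0}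
    {U₀ U₁ : EuclideanSpace ℝ (Fin 3) → EuclideanSpace ℝ (Fin 3)} {θa θb : ℝ} (hab : θb - θa ≠ 0)
    (hmA : AEStronglyMeasurable (fun x => U₀ x + θa • U₁ x) volume)
    (hmB : AEStronglyMeasurable (fun x => U₀ x + θb • U₁ x) volume) {L₀ : ℝ} (hL₀ : 1 ≤ L₀)
    (hbounds : ∀ L : ℝ, L₀ ≤ L →
      (∫⁻ x in ball (0 : EuclideanSpace ℝ (Fin 3)) L, ‖U₀ x + θa • U₁ x‖ₑ ^ 2 ≤ ENNReal.ofReal ((c : ℝ) * L ^ (1 - 2 * ρ))) ∧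
      (∫⁻ x in ball (0 : EuclideanSpace ℝ (Fin 3)) L, ‖U₀ x + θb • U₁ x‖ₑ ^ 2 ≤ ENNReal.ofReal ((c : ℝ) * L ^ (1 - 2 * ρ))))
    {C₀ : EuclideanSpace ℝ (Fin 3)} (hC₀ : U₀ =ᵐ[volume] fun _ => C₀) : C₀ = 0 := by
  set Kr : ℝ := 2 * (c : ℝ) + 2 * θa ^ 2 * (4 * (c : ℝ) / (θb - θa) ^ 2) with hKr
  have hKr0 : 0 ≤ Kr := by positivity
  have hgrow : ∀ L : ℝ, L₀ ≤ L →
      ∫⁻ x in ball (0 : EuclideanSpace ℝ (Fin 3)) L, ‖(fun _ : EuclideanSpace ℝ (Fin 3) => C₀) x‖ₑ ^ 2 ≤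
        ENNReal.ofReal Kr * ENNReal.ofReal (L ^ (1 - 2 * ρ)) := by
    intro L hL
    have hL0 : 0 < L := by linarith
    obtain ⟨hb₁, hb₂⟩ := hbounds L hL
    have hkey := AffinePast.lintegral_coeff_le_of_two_slices
      (μ := volume.restrict (ball (0 : EuclideanSpace ℝ (Fin 3)) L)) hmB.restrict hb₁ hb₂
    have hY : 0 < (θb - θa) ^ 2 := by positivity
    have hXY : ENNReal.ofReal ((θb - θa) ^ 2) ≤ ‖θb - θa‖ₑ ^ 2 := by
      rw [Real.enorm_eq_ofReal_abs, ← ENNReal.ofReal_pow (abs_nonneg _), sq_abs]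
    have hU₁L : ∫⁻ x in ball (0 : EuclideanSpace ℝ (Fin 3)) L, ‖U₁ x‖ₑ ^ 2 ≤
        ENNReal.ofReal (4 * ((c : ℝ) * L ^ (1 - 2 * ρ)) / (θb - θa) ^ 2) :=
      ModulatedPast.lintegral_le_of_gap hY hXY hkey
    have hpt : ∀ᵐ x ∂(volume.restrict (ball (0 : EuclideanSpace ℝ (Fin 3)) L)),
        ‖(fun _ : EuclideanSpace ℝ (Fin 3) => C₀) x‖ₑ ^ 2 ≤ 2 * ‖U₀ x + θa • U₁ x‖ₑ ^ 2 + 2 * (‖θa‖ₑ ^ 2 * ‖U₁ x‖ₑ ^ 2) := by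
      filter_upwards [ae_restrict_of_ae hC₀] with x hx
      have e : C₀ = U₀ x + θa • U₁ x - θa • U₁ x := by
        rw [add_sub_cancel_right]; exact hx.symm
      show ‖C₀‖ₑ ^ 2 ≤ _
      rw [e]
      have h := enorm_sq_sub_le' (U₀ x + θa • U₁ x) (θa • U₁ x)
      rw [enorm_smul, mul_pow, mul_add] at h
      exact h
    have hm2 : AEMeasurable (fun x => 2 * ‖U₀ x + θa • U₁ x‖ₑ ^ 2) (volume.restrict (ball (0 : EuclideanSpace ℝ (Fin 3)) L)) :=
      (hmA.restrict.enorm.pow_const 2).const_mul _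
    calc ∫⁻ x in ball (0 : EuclideanSpace ℝ (Fin 3)) L, ‖(fun _ : EuclideanSpace ℝ (Fin 3) => C₀) x‖ₑ ^ 2
        ≤ ∫⁻ x in ball (0 : EuclideanSpace ℝ (Fin 3)) L, (2 * ‖U₀ x + θa • U₁ x‖ₑ ^ 2 + 2 * (‖θa‖ₑ ^ 2 * ‖U₁ x‖ₑ ^ 2)) :=
          lintegral_mono_ae hpt
      _ = 2 * (∫⁻ x in ball (0 : EuclideanSpace ℝ (Fin 3)) L, ‖U₀ x + θa • U₁ x‖ₑ ^ 2) +
            2 * (‖θa‖ₑ ^ 2 * ∫⁻ x in ball (0 : EuclideanSpace ℝ (Fin 3)) L, ‖U₁ x‖ₑ ^ 2) := by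
          rw [lintegral_add_left' hm2, lintegral_const_mul' _ _ (by norm_num), lintegral_const_mul' _ _ (by norm_num),
            lintegral_const_mul' _ _ (ENNReal.pow_ne_top enorm_ne_top)]
      _ ≤ 2 * ENNReal.ofReal ((c : ℝ) * L ^ (1 - 2 * ρ)) +
            2 * (‖θa‖ₑ ^ 2 * ENNReal.ofReal (4 * ((c : ℝ) * L ^ (1 - 2 * ρ)) / (θb - θa) ^ 2)) := by gcongr
      _ = ENNReal.ofReal Kr * ENNReal.ofReal (L ^ (1 - 2 * ρ)) := by
          rw [Real.enorm_eq_ofReal_abs, ← ENNReal.ofReal_pow (abs_nonneg _), sq_abs, ← ENNReal.ofReal_ofNat,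
            ← ENNReal.ofReal_mul (by norm_num), ← ENNReal.ofReal_mul (sq_nonneg _), ← ENNReal.ofReal_mul (by norm_num),
            ← ENNReal.ofReal_add (by positivity) (by positivity), ← ENNReal.ofReal_mul hKr0]
          congr 1
          rw [hKr]
          field_simp
  obtain ⟨C', hC', hCgrow⟩ := Shifted.growth_of_growth_le (V := fun _ : EuclideanSpace ℝ (Fin 3) => C₀)
    continuous_const (by linarith : 1 - 2 * ρ ≤ 3) hL₀ ENNReal.ofReal_ne_top hgrow
  exact NoDrift.eq_zero_of_const_of_lintegral_ball_le hC' (by linarith) hCgrow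

/-- **STEADY FIELD + EVANESCENT SQUARE-INTEGRABLY MODULATED `C¹` PATTERN ⇒ TRIVIAL** (`0 < ρ ≤ ½`). [folklore] -/
theorem ae_eq_zero_of_gauge_of_aeEvanescentPattern {ρ : ℝ} (hρ : 0 < ρ) (hρh : ρ ≤ 1 / 2)
    {u : ℝ → EuclideanSpace ℝ (Fin 3) → EuclideanSpace ℝ (Fin 3)} {p : ℝ → EuclideanSpace ℝ (Fin 3) → ℝ}
    {H : ℝ → EuclideanSpace ℝ (Fin 3) → EuclideanSpace ℝ (Fin 3) →L[ℝ] EuclideanSpace ℝ (Fin 3)} {c : ℝ≥0}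
    (hsw : IsSuitableWeakSolutionOn (slab (EuclideanSpace ℝ (Fin 3)) (Iio 0) isOpen_Iio) 0 0 u p)
    (hH : HasWeakSpatialGradientOn (slab (EuclideanSpace ℝ (Fin 3)) (Iio 0) isOpen_Iio) u H)
    (hc : ∀ a : ℝ, 0 < a → ENNReal.ofReal (a ^ (2 * ρ)) * cknA a (0 : ℝ × EuclideanSpace ℝ (Fin 3)) u +
        ENNReal.ofReal (a ^ ρ) * cknE a (0 : ℝ × EuclideanSpace ℝ (Fin 3)) H +
        ENNReal.ofReal (a ^ (2 * ρ)) * cknD a (0 : ℝ × EuclideanSpace ℝ (Fin 3)) p ≤ (c : ℝ≥0∞))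
    {T₁ : ℝ} (hT₁ : T₁ ≤ 0) {θ : ℝ → ℝ} (hθ1 : ContDiff ℝ 1 θ) (hlim : Tendsto θ atBot (𝓝 0))
    (hsq : ∃ κ : ℝ, 0 ≤ κ ∧ ∀ b : ℝ, ∫⁻ t in Ioo (-(b ^ 2)) T₁, ‖θ t‖ₑ ^ 2 ≤ ENNReal.ofReal κ)
    {U₀ U₁ : EuclideanSpace ℝ (Fin 3) → EuclideanSpace ℝ (Fin 3)}
    (hU : ∀ᵐ z ∂(volume.restrict (Iio T₁ ×ˢ (univ : Set (EuclideanSpace ℝ (Fin 3))))),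
      u z.1 z.2 = U₀ z.2 + θ z.1 • U₁ z.2) :
    uncurry u =ᵐ[volume.restrict (Iio (0 : ℝ) ×ˢ (univ : Set (EuclideanSpace ℝ (Fin 3))))] 0 := by
  obtain ⟨κ, hκ0, hκ⟩ := hsq
  have hθc : Continuous θ := hθ1.continuous
  have hE : ∀ a : ℝ, 0 < a →
      ENNReal.ofReal (a ^ ρ) * cknE a (0 : ℝ × EuclideanSpace ℝ (Fin 3)) H ≤ (c : ℝ≥0∞) :=
    fun a ha => le_trans (le_trans le_add_self le_self_add) (hc a ha)
  have hA : ∀ a : ℝ, 0 < a → ENNReal.ofReal (a ^ (2 * ρ)) *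
      cknA a (0 : ℝ × EuclideanSpace ℝ (Fin 3)) u ≤ (c : ℝ≥0∞) :=
    fun a ha => le_trans (le_trans le_self_add le_self_add) (hc a ha)
  -- ## (0) `θ ≡ 0` on the past
  by_cases hzero : ∀ t, t < T₁ → θ t = 0
  · have hU' : ∀ᵐ z ∂(volume.restrict (Iio T₁ ×ˢ (univ : Set (EuclideanSpace ℝ (Fin 3))))), u z.1 z.2 = U₀ z.2 := by
      filter_upwards [hU, ae_restrict_mem (measurableSet_Iio.prod MeasurableSet.univ)] with z hz hzm
      rw [hz, hzero z.1 (mem_prod.1 hzm).1, zero_smul, add_zero]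
    exact AePastSteady.ae_eq_zero_of_gauge_of_aePastSteady hρ hsw hH hc hT₁ hU'
  push Not at hzero
  obtain ⟨t₁, ht₁, hθt₁⟩ := hzero
  set ε : ℝ := |θ t₁| / 3 with hε
  have hεpos : 0 < ε := by positivity
  -- ## (1) good slices, window, threshold
  set S : Set ℝ := {τ | HasWeakFDerivOn (⊤ : Opens (EuclideanSpace ℝ (Fin 3))) volume (u τ) (H τ) ∧
    u τ =ᵐ[volume] fun x => U₀ x + θ τ • U₁ x} with hSdef
  have hS : ∀ᵐ τ ∂(volume.restrict (Iio T₁)), τ ∈ S := by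
    filter_upwards [FrameSteady.ae_hasWeakFDerivOn_slice_past hH hT₁,
      AffinePast.ae_ae_of_ae_slab (P := fun τ x => u τ x = U₀ x + θ τ • U₁ x) hU] with τ hτ hτ'
    exact ⟨hτ, hτ'⟩
  have hW : ∀ τ, τ ∈ S →
      HasWeakFDerivOn (⊤ : Opens (EuclideanSpace ℝ (Fin 3))) volume (fun x => U₀ x + θ τ • U₁ x) (H τ) :=
    fun τ hτ => SeparablePast.hasWeakFDerivOn_congr_ae hτ.1 hτ.2
  have hSm : ∀ t, t ∈ S → AEStronglyMeasurable (H t) volume := by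
    intro t ht
    have h1 := ht.1.locallyIntegrableOn_deriv.aestronglyMeasurable
    rwa [Opens.coe_top, Measure.restrict_univ] at h1
  have hevJ : ∀ᶠ s in 𝓝 t₁, 2 * ε < |θ s| ∧ s < T₁ := by
    refine Filter.Eventually.and ?_ (Iio_mem_nhds ht₁)
    have h2 : 2 * ε < |θ t₁| := by rw [hε]; linarith [abs_pos.2 hθt₁]
    exact ((continuous_abs.comp hθc).continuousAt (x := t₁)).eventually (lt_mem_nhds h2)
  obtain ⟨δ, hδ, hJ'⟩ := Metric.mem_nhds_iff.1 hevJ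
  have hJ : ∀ s, s ∈ ball t₁ δ → 2 * ε < |θ s| ∧ s < T₁ := fun s hs => hJ' hs
  obtain ⟨M, hMT, hM⟩ : ∃ M : ℝ, M ≤ T₁ ∧ ∀ s, s ≤ M → |θ s| ≤ ε := by
    obtain ⟨M, hM⟩ := eventually_atBot.1 ((Metric.tendsto_nhds.1 hlim) ε hεpos)
    refine ⟨min M T₁, min_le_right _ _, fun s hs => ?_⟩
    have := hM s (hs.trans (min_le_left _ _))
    rw [Real.dist_eq, sub_zero] at this
    exact this.le
  obtain ⟨τa, hτaJ, hτaS⟩ : ∃ τ, τ ∈ ball t₁ δ ∧ τ ∈ S :=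
    Measure.exists_mem_of_measure_ne_zero_of_ae (measure_ball_pos volume t₁ hδ).ne'
      (ae_restrict_of_ae_restrict_of_subset (fun s hs => (hJ s hs).2) hS)
  obtain ⟨τb, hτbI, hτbS⟩ : ∃ τ, τ ∈ Ioo (M - 1) M ∧ τ ∈ S := by
    have hwin : volume (Ioo (M - 1) M) ≠ 0 := by rw [Real.volume_Ioo]; exact (ENNReal.ofReal_pos.2 (by linarith)).ne'
    exact Measure.exists_mem_of_measure_ne_zero_of_ae hwin
      (ae_restrict_of_ae_restrict_of_subset (fun s hs => lt_of_lt_of_le hs.2 hMT) hS)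
  have hτaT : τa < T₁ := (hJ τa hτaJ).2
  have hτa0 : τa < 0 := lt_of_lt_of_le hτaT hT₁
  have hτb0 : τb < 0 := lt_of_lt_of_le (lt_of_lt_of_le hτbI.2 hMT) hT₁
  have hab : θ τb - θ τa ≠ 0 := by
    intro h0
    have e : |θ τa| = |θ τb| := by rw [sub_eq_zero.1 h0]
    linarith [(hJ τa hτaJ).1, hM τb hτbI.2.le]
  -- ## (2) gradients and the engine
  obtain ⟨hGU₁, hGU₀, hrel⟩ := gradients_of_two_slices hW hτaS hτbS hab
  set G₁ : EuclideanSpace ℝ (Fin 3) → EuclideanSpace ℝ (Fin 3) →L[ℝ] EuclideanSpace ℝ (Fin 3) :=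
    (θ τb - θ τa)⁻¹ • (H τb - H τa) with hG₁def
  set G₀ : EuclideanSpace ℝ (Fin 3) → EuclideanSpace ℝ (Fin 3) →L[ℝ] EuclideanSpace ℝ (Fin 3) := H τa - θ τa • G₁ with hG₀def
  set VJ : ℝ≥0∞ := volume (ball t₁ δ) with hVJ
  have hVJpos : VJ ≠ 0 := (measure_ball_pos volume t₁ hδ).ne'
  have hVJtop : VJ ≠ ⊤ := measure_ball_lt_top.ne
  set vJ : ℝ := VJ.toReal with hvJ
  have hvJpos : 0 < vJ := ENNReal.toReal_pos hVJpos hVJtop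
  set K : ℝ := 2 * (c : ℝ) + 2 * κ * (8 * (c : ℝ) / (ε ^ 2 * vJ)) with hK
  have hK0 : 0 ≤ K := by positivity
  have hball0 : ∀ r : ℝ, 0 < r → ∫⁻ y in ball (0 : EuclideanSpace ℝ (Fin 3)) r, ENNReal.ofReal (frobeniusNormSq (G₀ y)) = 0 := by
    intro r hr
    have hlimK : Tendsto (fun b : ℝ => ENNReal.ofReal (2 * K * b ^ (-(1 + ρ)))) atTop (𝓝 0) := by
      rw [show (0 : ℝ≥0∞) = ENNReal.ofReal (2 * K * 0) by simp]
      exact ENNReal.tendsto_ofReal ((tendsto_rpow_neg_atTop (by linarith)).const_mul _)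
    refine nonpos_iff_eq_zero.1 (ge_of_tendsto hlimK ?_)
    filter_upwards [eventually_ge_atTop r, eventually_gt_atTop 0, eventually_ge_atTop (Real.sqrt (2 * |M - 1| + 2 * |T₁| + 4) + 1)]
      with b hbr hb0 hbig
    have hb2 : 2 * |M - 1| + 2 * |T₁| + 4 ≤ b ^ 2 := by
      have h1 : Real.sqrt (2 * |M - 1| + 2 * |T₁| + 4) ^ 2 = 2 * |M - 1| + 2 * |T₁| + 4 := Real.sq_sqrt (by positivity)
      nlinarith [Real.sqrt_nonneg (2 * |M - 1| + 2 * |T₁| + 4)]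
    have hbM : -(b ^ 2) < M - 1 := by linarith [neg_abs_le (M - 1), abs_nonneg (M - 1), abs_nonneg T₁]
    obtain ⟨h1, h2⟩ := engine hH hE hT₁ hθc.measurable hS hSm hrel hεpos.le hJ hMT hM hb0 hbM
    have hvolI : ENNReal.ofReal (b ^ 2 / 2) ≤ volume (Ioo (-(b ^ 2)) T₁) := by
      rw [Real.volume_Ioo]; exact ENNReal.ofReal_le_ofReal (by linarith [neg_abs_le T₁, abs_nonneg (M - 1), abs_nonneg T₁])
    have hvolI' : volume (Ioo (-(b ^ 2)) T₁) ≤ ENNReal.ofReal (b ^ 2) := by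
      rw [Real.volume_Ioo]; exact ENNReal.ofReal_le_ofReal (by linarith)
    have hvolIf : ENNReal.ofReal (b ^ 2 / 2) ≤ volume (Ioo (-(b ^ 2)) (M - 1)) := by
      rw [Real.volume_Ioo]; exact ENNReal.ofReal_le_ofReal (by linarith [neg_abs_le (M - 1), abs_nonneg (M - 1), abs_nonneg T₁])
    -- (a) ⇒ bound on `∫ |G₁|²`
    have hIg₁ : ∫⁻ y in ball (0 : EuclideanSpace ℝ (Fin 3)) b, ENNReal.ofReal (frobeniusNormSq (G₁ y)) ≤
        ENNReal.ofReal (8 * (c : ℝ) / (ε ^ 2 * vJ) * b ^ (1 - ρ)) := by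
      have hY : 0 < ε ^ 2 * (b ^ 2 / 2) * vJ := by positivity
      have hXY : ENNReal.ofReal (ε ^ 2 * (b ^ 2 / 2) * vJ) ≤
          ENNReal.ofReal (ε ^ 2) * (volume (Ioo (-(b ^ 2)) (M - 1)) * volume (ball t₁ δ)) := by
        rw [ENNReal.ofReal_mul (by positivity), ENNReal.ofReal_mul (by positivity), ← hVJ,
          show ENNReal.ofReal vJ = VJ from ENNReal.ofReal_toReal hVJtop, mul_assoc]
        gcongr
      have h1' : ENNReal.ofReal (ε ^ 2) * (volume (Ioo (-(b ^ 2)) (M - 1)) * volume (ball t₁ δ)) *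
          ∫⁻ y in ball (0 : EuclideanSpace ℝ (Fin 3)) b, ENNReal.ofReal (frobeniusNormSq (G₁ y)) ≤
            4 * ENNReal.ofReal (b ^ 2 * ((c : ℝ) * b ^ (1 - ρ))) := by
        refine h1.trans ?_
        rw [ENNReal.ofReal_mul (p := b ^ 2) (q := (c : ℝ) * b ^ (1 - ρ)) (by positivity), ← mul_assoc]
        exact mul_le_mul' (mul_le_mul' le_rfl hvolI') le_rfl
      refine (ModulatedPast.lintegral_le_of_gap hY hXY h1').trans (le_of_eq ?_)
      congr 1
      field_simp
      ring
    -- (b) ⇒ window bound for `G₀`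
    have h4 : volume (Ioo (-(b ^ 2)) T₁) * ∫⁻ y in ball (0 : EuclideanSpace ℝ (Fin 3)) b, ENNReal.ofReal (frobeniusNormSq (G₀ y)) ≤
        ENNReal.ofReal (K * b ^ (1 - ρ)) := by
      refine h2.trans ?_
      calc 2 * ENNReal.ofReal ((c : ℝ) * b ^ (1 - ρ)) + 2 * ((∫⁻ t in Ioo (-(b ^ 2)) T₁, ‖θ t‖ₑ ^ 2) *
            ∫⁻ y in ball (0 : EuclideanSpace ℝ (Fin 3)) b, ENNReal.ofReal (frobeniusNormSq (G₁ y)))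
          ≤ 2 * ENNReal.ofReal ((c : ℝ) * b ^ (1 - ρ)) +
              2 * (ENNReal.ofReal κ * ENNReal.ofReal (8 * (c : ℝ) / (ε ^ 2 * vJ) * b ^ (1 - ρ))) := by
            gcongr
            exact hκ b
        _ = ENNReal.ofReal (K * b ^ (1 - ρ)) := by
            rw [hK, ← ENNReal.ofReal_ofNat, ← ENNReal.ofReal_mul (by norm_num), ← ENNReal.ofReal_mul hκ0,
              ← ENNReal.ofReal_mul (by norm_num), ← ENNReal.ofReal_add (by positivity) (by positivity)]
            congr 1
            ring
    exact (lintegral_mono_set (ball_subset_ball hbr)).trans (le_of_window_mul_le hb0 hvolI h4)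
  -- ## (3) `G₀ = 0` a.e., `U₀ ≡ C₀`
  have hG₀meas : AEStronglyMeasurable G₀ volume := by
    have h := hGU₀.locallyIntegrableOn_deriv.aestronglyMeasurable
    rwa [Opens.coe_top, Measure.restrict_univ] at h
  have hfrob0 : ∀ L : EuclideanSpace ℝ (Fin 3) →L[ℝ] EuclideanSpace ℝ (Fin 3), frobeniusNormSq L = 0 → L = 0 := by
    intro L h
    rw [frobeniusNormSq_eq_sum (stdOrthonormalBasis ℝ (EuclideanSpace ℝ (Fin 3)))] at h
    have h0 : ∀ i, L (stdOrthonormalBasis ℝ (EuclideanSpace ℝ (Fin 3)) i) = 0 := by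
      intro i
      have := (Finset.sum_eq_zero_iff_of_nonneg (fun j _ => sq_nonneg _)).1 h i (Finset.mem_univ _)
      exact norm_eq_zero.1 ((pow_eq_zero_iff two_ne_zero).1 this)
    ext1 x
    rw [← (stdOrthonormalBasis ℝ (EuclideanSpace ℝ (Fin 3))).sum_repr x, map_sum]
    simp [h0]
  have hG0 : G₀ =ᵐ[volume] 0 := by
    have hballae : ∀ n : ℕ, ∀ᵐ y ∂volume, y ∈ ball (0 : EuclideanSpace ℝ (Fin 3)) ((n : ℝ) + 1) → G₀ y = 0 := by
      intro n
      have hmeas : AEMeasurable (fun y => ENNReal.ofReal (frobeniusNormSq (G₀ y)))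
          (volume.restrict (ball (0 : EuclideanSpace ℝ (Fin 3)) ((n : ℝ) + 1))) :=
        ((ENNReal.continuous_ofReal.comp continuous_frobeniusNormSq').comp_aestronglyMeasurable hG₀meas.restrict).aemeasurable
      have h := (lintegral_eq_zero_iff' hmeas).1 (hball0 _ (by positivity))
      rw [Filter.EventuallyEq, ae_restrict_iff' measurableSet_ball] at h
      filter_upwards [h] with y hy hyb
      have h1 := hy hyb
      simp only [Pi.zero_apply, ENNReal.ofReal_eq_zero] at h1
      exact hfrob0 _ (le_antisymm h1 (frobeniusNormSq_nonneg _))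
    filter_upwards [ae_all_iff.2 hballae] with y hy
    obtain ⟨n, hn⟩ := exists_nat_gt ‖y‖
    exact hy n (by rw [mem_ball_zero_iff]; linarith)
  have hW0 : HasWeakFDerivOn (⊤ : Opens (EuclideanSpace ℝ (Fin 3))) volume U₀ 0 :=
    { locallyIntegrableOn := hGU₀.locallyIntegrableOn
      locallyIntegrableOn_deriv :=
        (locallyIntegrable_const (0 : EuclideanSpace ℝ (Fin 3) →L[ℝ] EuclideanSpace ℝ (Fin 3))).locallyIntegrableOn _
      integral_fderiv_smul_eq := fun φ w hφ => by
        rw [hGU₀.integral_fderiv_smul_eq φ w hφ]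
        congr 1
        refine integral_congr_ae ?_
        filter_upwards [ae_restrict_of_ae hG0] with y hy
        rw [hy] }
  obtain ⟨C₀, hC₀⟩ := ae_eq_const_of_hasWeakFDerivOn_zero hW0
  -- ## (4) `C₀ = 0`
  have hmA : AEStronglyMeasurable (fun x => U₀ x + θ τa • U₁ x) volume := by
    have h := hτaS.1.locallyIntegrableOn.aestronglyMeasurable
    rw [Opens.coe_top, Measure.restrict_univ] at h
    exact h.congr hτaS.2
  have hmB : AEStronglyMeasurable (fun x => U₀ x + θ τb • U₁ x) volume := by
    have h := hτbS.1.locallyIntegrableOn.aestronglyMeasurable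
    rw [Opens.coe_top, Measure.restrict_univ] at h
    exact h.congr hτbS.2
  have hC₀0 : C₀ = 0 := by
    refine const_eq_zero_of_two_slices (c := c) (L₀ := Real.sqrt (-τa) + Real.sqrt (-τb) + 1) hρ hab hmA hmB
      (by linarith [Real.sqrt_nonneg (-τa), Real.sqrt_nonneg (-τb)]) (fun L hL => ?_) hC₀
    have hsa : 0 ≤ Real.sqrt (-τa) := Real.sqrt_nonneg _
    have hsb : 0 ≤ Real.sqrt (-τb) := Real.sqrt_nonneg _
    have hL0 : 0 < L := by linarith
    have hwin : ∀ σ : ℝ, σ < 0 → Real.sqrt (-σ) < L → σ ∈ Ioo (-(L ^ 2)) 0 := by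
      intro σ hσ hσL
      refine ⟨?_, hσ⟩
      have h1 : Real.sqrt (-σ) ^ 2 = -σ := Real.sq_sqrt (by linarith)
      have h3 : Real.sqrt (-σ) ^ 2 < L ^ 2 := pow_lt_pow_left₀ hσL (Real.sqrt_nonneg _) two_ne_zero
      linarith
    constructor
    · refine le_of_eq_of_le ?_ (Backward.lintegral_ball_le_of_gaugeA hL0 (hA L hL0) (hwin τa hτa0 (by linarith)))
      refine lintegral_congr_ae (ae_restrict_of_ae ?_)
      filter_upwards [hτaS.2] with x hx
      rw [hx]
    · refine le_of_eq_of_le ?_ (Backward.lintegral_ball_le_of_gaugeA hL0 (hA L hL0) (hwin τb hτb0 (by linarith)))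
      refine lintegral_congr_ae (ae_restrict_of_ae ?_)
      filter_upwards [hτbS.2] with x hx
      rw [hx]
  -- ## (5) the member is separable: `u = θ(τ) U₁` a.e. on the past slab
  have hU' : ∀ᵐ z ∂(volume.restrict (Iio T₁ ×ˢ (univ : Set (EuclideanSpace ℝ (Fin 3))))), u z.1 z.2 = θ z.1 • U₁ z.2 := by
    have h0 : ∀ᵐ x ∂(volume : Measure (EuclideanSpace ℝ (Fin 3))), U₀ x = 0 := by
      filter_upwards [hC₀] with x hx; rw [hx, hC₀0]
    filter_upwards [hU, AffinePast.ae_slab_of_ae (T₁ := T₁) h0] with z hz hz0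
    rw [hz, hz0, zero_add]
  exact CollapseBridge.ae_eq_zero_of_gauge_of_aeSeparableC1 hρ hρh hsw hH hc hT₁ hθ1 hU'

end Evanescent

/-- **Binder language: STEADY FIELD + EVANESCENT SQUARE-INTEGRABLY MODULATED `C¹` PATTERN ⇒ TRIVIAL** — `u(τ, x) = U₀(x) + θ(τ)U₁(x)`
a.e. on `(−∞,T₁) × ℝ³` (`T₁ ≤ 0`; `U₀, U₁` arbitrary; `θ ∈ C¹(ℝ)`, `θ → 0` at `−∞`, `∫_{(−b²,T₁)} θ² ≤ κ` for all `b`) ⇒ `u = 0`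
a.e., window `0 < ρ ≤ ½` (`Evanescent.ae_eq_zero_of_gauge_of_aeEvanescentPattern`). [folklore] -/
theorem Birth.nonSelfSimilar_of_aeEvanescentPattern :
    ∀ ρ : ℝ, 0 < ρ → ρ ≤ 1 / 2 →
      ∀ (u : ℝ → EuclideanSpace ℝ (Fin 3) → EuclideanSpace ℝ (Fin 3)) (p : ℝ → EuclideanSpace ℝ (Fin 3) → ℝ)
        (H : ℝ → EuclideanSpace ℝ (Fin 3) → EuclideanSpace ℝ (Fin 3) →L[ℝ] EuclideanSpace ℝ (Fin 3)) (c : ℝ≥0),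
        Birth.InClass ρ u p H c →
          (∃ T₁ : ℝ, T₁ ≤ 0 ∧ ∃ θ : ℝ → ℝ, ∃ U₀ U₁ : EuclideanSpace ℝ (Fin 3) → EuclideanSpace ℝ (Fin 3),
              ContDiff ℝ 1 θ ∧ Tendsto θ atBot (𝓝 0) ∧
              (∃ κ : ℝ, 0 ≤ κ ∧ ∀ b : ℝ, ∫⁻ t in Ioo (-(b ^ 2)) T₁, ‖θ t‖ₑ ^ 2 ≤ ENNReal.ofReal κ) ∧
              ∀ᵐ z ∂(volume.restrict (Iio T₁ ×ˢ (univ : Set (EuclideanSpace ℝ (Fin 3))))),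
                u z.1 z.2 = U₀ z.2 + θ z.1 • U₁ z.2) →
          uncurry u =ᵐ[volume.restrict (Iio (0 : ℝ) ×ˢ (univ : Set (EuclideanSpace ℝ (Fin 3))))] 0 := by
  intro ρ hρ hρh u p H c hcl h
  obtain ⟨T₁, hT₁, θ, U₀, U₁, hθ1, hlim, hsq, hU⟩ := h
  exact Evanescent.ae_eq_zero_of_gauge_of_aeEvanescentPattern hρ hρh hcl.1 hcl.2.1 hcl.2.2 hT₁ hθ1 hlim hsq hU

end Summit.NavierStokesRegularity.NavierStokesRegularity.Theorems.PowerGaugeEulerLiouville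

end
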